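import Literature.NumberTheory.LFunctions.BPZFirstMomentSingularSum
import HarnessLib

/-!
# Bui–Pratt–Zaharescu 2024, §2 (2.5) and §6 (6.5): the second-moment singular sum `S₂(u,v)` as a
# functional of GENERAL mollifier coefficients (definitions only; no named fact)

Source: H. M. Bui, K. Pratt, A. Zaharescu, *Analytic ranks of automorphic L-functions and
Landau–Siegel zeros*, J. London Math. Soc. 109 (2024) = arXiv:2102.03087 [held:
paper:arxiv-2102.03087], §2.1 (2.4)–(2.5) p. 5 and §6 pp. 17–18 ((6.4)–(6.5)). Continues
`BPZFirstMomentSingularSum` (namespace `BPZ2024`).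

CONTENT. By the Hecke relation the square of the mollifier is again a one-piece linear form,
`M²_{f,ψ} = Σ_{a ≤ X²} ρ₂(a)λ_f(a)a^{−1/2}` (2.4) with
`ρ₂(a) = Σ_{d ≤ X} d^{−1} Σ_{a₁a₂ = a, a₁,a₂ ≤ X/d} ρ₁(da₁)ρ₁(da₂)` (2.5), and the diagonal main term of
the mollified second moments `Σʰ Λ^{(k)}_{f,ψ}(½)² M²_{f,ψ}` is a double contour integral of
`G(u)G(v)Γ(1+u)²Γ(1+v)² Q^{u+v} L(1+2u,ψ)L(1+2v,ψ) W(u,v) (uv)^{−k−1}` (p. 17–18) with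
`W(u,v) = S₂(u,v) + O_ε(L(1,ψ)(log q)^{33+ε}) + O_A((log q)^{−A})` (6.4) and
`S₂(u,v) = Σ_{ab ≤ X²} ρ₂(ab) a^{−1−u} b^{−1−v} Σ_{n ≤ X} (1⋆ψ)(an)(1⋆ψ)(bn) n^{−1−u−v}` (6.5). Thus
the second-moment main term is the QUADRATIC functional `ρ ↦ S₂(u,v)[ρ]` of the coefficient
sequence (through `ρ₂ = ρ₂[ρ]`). This file types `ρ₂[ρ]` and `S₂(u,v)[ρ]` for an arbitrary `ρ`
(the cell's «BPZcompat.secondForm» `= singularSum2 ρ ψ X 0 0`, B-fam/PLAN.md v1.3 §9b/§10,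
derivation D-fam-2) and records `rho2 (rho1 ψ)` / `S2uv` as the printed instances. NOTHING is
asserted: the evaluations (Props. 6.1/6.2, (6.4), §§7–13) are printed for `ρ = ρ₁` only and are left
to a facts file (reading map: (6.1)–(6.3) p. 17, Prop. 6.1/6.2 p. 17, Lemma 7.1 p. 19ff, §§8–13
pp. 22–42). FRAMING: the programme SEARCHES and TYPES; nothing here is a claim about Landau–Siegel
zeros.

## References

* [BuiPrattZaharescu2023] §2.1 (2.4)–(2.5) p. 5; §6 (6.4)–(6.5) pp. 17–18.
-/

noncomputable section

open scoped Real
open Complex Finset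

namespace Literature.NumberTheory.LFunctions

namespace BPZ2024

variable {D : ℕ}

/-- **`ρ₂[ρ](a) = Σ_{1 ≤ d ≤ X} d^{−1} Σ_{a₁a₂ = a, a₁ ≤ X/d, a₂ ≤ X/d} ρ(da₁)ρ(da₂)`** — the
coefficients of the SQUARE of the one-piece mollifier `Σ_{a≤X} ρ(a)λ_f(a)a^{−1/2}` after the Hecke
relation (BPZ (2.4)–(2.5), printed for `ρ = ρ₁`; the computation (Lemma 3.1) is the same for any
`ρ`). [cite: BuiPrattZaharescu2023, §2.1 (2.5)] -/
def rho2 (ρ : ℕ → ℂ) (X : ℝ) (a : ℕ) : ℂ :=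
  ∑ d ∈ Icc 1 ⌊X⌋₊, (d : ℂ)⁻¹ *
    ∑ p ∈ a.divisorsAntidiagonal,
      if (p.1 : ℝ) ≤ X / d ∧ (p.2 : ℝ) ≤ X / d then ρ (d * p.1) * ρ (d * p.2) else 0

/-- **The second-moment singular sum as a functional of the coefficients** (BPZ (6.5), printed for
`ρ = ρ₁`): `singularSum2 ρ ψ X u v = Σ_{a,b ≥ 1, ab ≤ X²} ρ₂[ρ](ab) a^{−(1+u)} b^{−(1+v)}
Σ_{1 ≤ n ≤ X} (1⋆ψ)(an)(1⋆ψ)(bn) n^{−(1+u+v)}`. The cell's «BPZcompat.secondForm» is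
`singularSum2 ρ ψ X 0 0` (definition only). [cite: BuiPrattZaharescu2023, §6 (6.5)] -/
def singularSum2 (ρ : ℕ → ℂ) (ψ : DirichletCharacter ℂ D) (X : ℝ) (u v : ℂ) : ℂ :=
  ∑ a ∈ Icc 1 ⌊X ^ 2⌋₊, ∑ b ∈ Icc 1 ⌊X ^ 2⌋₊,
    if ((a * b : ℕ) : ℝ) ≤ X ^ 2 then
      rho2 ρ X (a * b) * (a : ℂ) ^ (-(1 + u)) * (b : ℂ) ^ (-(1 + v)) *
        ∑ n ∈ Icc 1 ⌊X⌋₊, oneStarPsi ψ (a * n) * oneStarPsi ψ (b * n) * (n : ℂ) ^ (-(1 + u + v))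
    else 0

/-- **`ρ₂` of (2.5)**: the printed instance `ρ₂ = ρ₂[ρ₁]`. [cite: BuiPrattZaharescu2023, §2.1 (2.5)] -/
def rho2bpz (ψ : DirichletCharacter ℂ D) (X : ℝ) (a : ℕ) : ℂ :=
  rho2 (rho1 ψ) X a

/-- **`S₂(u,v)` of (6.5)**: the printed instance at `ρ = ρ₁`, as a function of `(u, v)`.
[cite: BuiPrattZaharescu2023, §6 (6.5)] -/
def S2uv (ψ : DirichletCharacter ℂ D) (X : ℝ) (u v : ℂ) : ℂ :=
  singularSum2 (rho1 ψ) ψ X u v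

/-- `S₂(u,v)` is the second singular-sum functional at `ρ = ρ₁`. [cite: BuiPrattZaharescu2023, §6 (6.5)] -/
theorem singularSum2_rho1 (ψ : DirichletCharacter ℂ D) (X : ℝ) :
    S2uv ψ X = singularSum2 (rho1 ψ) ψ X := rfl

/-- `ρ₂ = ρ₂[ρ₁]`. [cite: BuiPrattZaharescu2023, §2.1 (2.5)] -/
theorem rho2bpz_eq (ψ : DirichletCharacter ℂ D) (X : ℝ) : rho2bpz ψ X = rho2 (rho1 ψ) X := rfl

end BPZ2024

end Literature.NumberTheory.LFunctions

end
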